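import Summits.ValiantsHypothesis.ValiantsHypothesis.Theses.DivisionGap
import Summits.ValiantsHypothesis.ValiantsHypothesis.Theorems.DivisionGapZeroOneTransferSplit
import Summits.ValiantsHypothesis.ValiantsHypothesis.Theorems.DivisionGapZeroOneTransferCofactorChargingOfMonotoneKaltofen

/-!
# Crux `DivisionGap.ZeroOneTransfer` (stmt-ValiantsHypothesis-5066), line `charged-uncharged` —
# stub `perMultiplesHard_of_monotoneKaltofen`

**Theorem (`perMultiplesHard_of_monotoneKaltofen`).** The clean charging statement "monotone
Kaltofen" (MK):

> there is `k` such that for every finite variable type `τ`, every `f` and every nonzero `h` in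
> `ℝ≥0[τ]` there is a nonzero `h'` with
> `L₊(f h') + L₊(h') ≤ 2 ^ ((log₂ #τ + log₂ L₊(f h) + k) ^ k)`

closes the charged/uncharged gap on the H1 side of route `DivisionGap`:
`MK → PerDivisionHard → PerMultiplesHard`.  Here `L₊ = complexity` is the least size of a
fan-in-two arithmetic circuit over the semiring `ℝ≥0`, `PerDivisionHard` (H1 charged) says
`2 ^ ((log₂ n + c) ^ c) < L₊(per_n h) + L₊(h)` for all `c`, all large `n` and all nonzero `h`, and
`PerMultiplesHard` (H1 uncharged) drops the charge `L₊(h)`.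

## Proof

Fix `k` from MK and `c`.  Exponent bookkeeping (`MonotoneKaltofenH1.exponent_absorb`, from
`Split.qp_absorb` and `MonotoneKaltofen.exponent_le`) gives `C` with
`(v + L + k) ^ k ≤ (log₂ n + C) ^ C` whenever `v ≤ 3 (log₂ n + 1) + 2` and `L ≤ (log₂ n + c) ^ c`.
Take `n₀` from `PerDivisionHard` at `C`.  For `n ≥ n₀` and `h ≠ 0` suppose, for contradiction,
`L₊(per_n h) ≤ 2 ^ ((log₂ n + c) ^ c)`.  MK at `τ := Fin n × Fin n`, `f := per_n` yields a nonzero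
`h'` with `L₊(per_n h') + L₊(h') ≤ 2 ^ ((v + L + k) ^ k)` where `v = log₂ (n · n) ≤ 3 (log₂ n + 1) + 2`
(`MonotoneKaltofen.log_card_le`, as `n · n ≤ n ^ 2 + 2`) and `L = log₂ L₊(per_n h) ≤ (log₂ n + c) ^ c`;
hence `L₊(per_n h') + L₊(h') ≤ 2 ^ ((log₂ n + C) ^ C)`, contradicting `PerDivisionHard` at `C, n, h'`.
[folklore]
-/

noncomputable section

-- Sub = Summit single-conjunct layout: the duplicated namespace component is mandated by the tree.
set_option linter.dupNamespace false

namespace Summit.ValiantsHypothesis.ValiantsHypothesis.Theorems.DivisionGapZeroOneTransfer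

open Literature.Computability.AlgebraicComplexity
open Summit.ValiantsHypothesis.ValiantsHypothesis.Theses.DivisionGap
open scoped NNReal

namespace MonotoneKaltofenH1

/-- The variable count of `per_n · h`: `#(Fin n × Fin n) = n · n ≤ n ^ 2 + 2`. [folklore] -/
theorem card_le (n : ℕ) : Fintype.card (Fin n × Fin n) ≤ n ^ 2 + 2 := by
  rw [Fintype.card_prod, Fintype.card_fin, sq]
  exact Nat.le_add_right _ _

/-- Exponent bookkeeping for the H1 transfer: for all `c k` there is `C` such that for every `a`
(think `a = log₂ n`), every `v ≤ 3 (a + 1) + 2` (the variable-count logarithm) and every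
`L ≤ (a + c) ^ c` (the logarithm of the uncharged cost), `(v + L + k) ^ k ≤ (a + C) ^ C`.
[folklore] -/
theorem exponent_absorb (c k : ℕ) :
    ∃ C : ℕ, ∀ a v L : ℕ, v ≤ (2 + 1) * (a + 1) + 2 → L ≤ (a + c) ^ c →
      (v + L + k) ^ k ≤ (a + C) ^ C := by
  obtain ⟨C, hC⟩ := Split.qp_absorb c (3 * (2 + 1) * (k + 1))
  refine ⟨C, fun a v L hv hL => ?_⟩
  calc (v + L + k) ^ k ≤ (v + (a + c) ^ c + k) ^ k := by gcongr
    _ ≤ (a + (a + c) ^ c + 3 * (2 + 1) * (k + 1)) ^ (3 * (2 + 1) * (k + 1)) :=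
        MonotoneKaltofen.exponent_le hv
    _ ≤ (a + C) ^ C := hC a

end MonotoneKaltofenH1

/-- **Monotone Kaltofen closes the charged/uncharged gap on the H1 side:
`MK → PerDivisionHard → PerMultiplesHard`.**  If every nonzero cofactor can be charged at
quasi-polynomial cost in the number of variables and in `L₊(f h)` (MK, the inline `∃ k`
hypothesis), then hardness of `per_n` for subtraction-free circuits with division in the charged
normal form (`PerDivisionHard`: `L₊(per_n h) + L₊(h)` super-quasi-polynomial) already gives the
uncharged form (`PerMultiplesHard`: `L₊(per_n h)` super-quasi-polynomial for every nonzero `h`):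
a cheap uncharged multiple `per_n h` is charged by MK into a cheap `per_n h'` with cheap `h'`,
the variable count `n · n` and the double quasi-polynomial being absorbed into the constant.
[folklore] -/
theorem perMultiplesHard_of_monotoneKaltofen :
    (∃ k : ℕ, ∀ (τ : Type) [Fintype τ] (f h : MvPolynomial τ NNReal), h ≠ 0 → ∃ h' : MvPolynomial τ NNReal, h' ≠ 0 ∧ Literature.Computability.AlgebraicComplexity.complexity (f * h') + Literature.Computability.AlgebraicComplexity.complexity h' ≤ 2 ^ ((Nat.log 2 (Fintype.card τ) + Nat.log 2 (Literature.Computability.AlgebraicComplexity.complexity (f * h)) + k) ^ k)) → Summit.ValiantsHypothesis.ValiantsHypothesis.Theses.DivisionGap.PerDivisionHard → Summit.ValiantsHypothesis.ValiantsHypothesis.Theses.DivisionGap.PerMultiplesHard := by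
  rintro ⟨k, hk⟩ hPDH c
  obtain ⟨C, hC⟩ := MonotoneKaltofenH1.exponent_absorb c k
  obtain ⟨n₀, hn₀⟩ := hPDH C
  refine ⟨n₀, fun n hn h hh => not_le.mp fun hle => ?_⟩
  obtain ⟨h', hh', hle'⟩ := hk (Fin n × Fin n) (perPoly (Fin n) NNReal) h hh
  have hlt := hn₀ n hn h' hh'
  have hv : Nat.log 2 (Fintype.card (Fin n × Fin n)) ≤ (2 + 1) * (Nat.log 2 n + 1) + 2 :=
    MonotoneKaltofen.log_card_le (MonotoneKaltofenH1.card_le n)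
  have hL : Nat.log 2 (complexity (perPoly (Fin n) NNReal * h)) ≤ (Nat.log 2 n + c) ^ c := by
    have := Nat.log_mono_right (b := 2) hle
    rwa [Nat.log_pow Nat.one_lt_two] at this
  exact absurd (hle'.trans (Nat.pow_le_pow_right Nat.two_pos (hC _ _ _ hv hL))) (not_le.mpr hlt)

end Summit.ValiantsHypothesis.ValiantsHypothesis.Theorems.DivisionGapZeroOneTransfer
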